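import Summits.AnomalousDissipation.AnomalousDissipation.Theses.NeutralTaylorWaves
import Summits.AnomalousDissipation.AnomalousDissipation.Theorems.NonresonantSelection.Negative.BorderedTestVectors
import Summits.AnomalousDissipation.AnomalousDissipation.Theorems.NewtonRealisation.Negative.TranslationKernel
import Summits.AnomalousDissipation.AnomalousDissipation.Theorems.NewtonRealisation.Negative.DriftAbsorptionZeroMean
import Summits.AnomalousDissipation.AnomalousDissipation.Theorems.NewtonRealisation.Negative.BorderedBoundShear

/-!
# Disproof of `NewtonRealisation` (stmt-AnomalousDissipation-16315) — findings

Standing disprover's work file (refuter-cdisprove-stmt-AnomalousDissipation-16315-0; cycle 1, v2,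
2026-08-17).  Crux: `NewtonRealisation : NonresonantTaylorWaves → B`, `B` = the steady zeroth-law family
(body of stmt-0219 `CoherentStates.SteadyZerothLaw`, verbatim).  Picked line (PICKED.md 11:44Z; reshape 1 13:10Z):
`Lines/Sketch.lean` — abstract stubs A `stub_borderedFredholm` (LANDED), B `stub_quadraticNewton` (LANDED),
lattice stubs L1 `stub_latticeDictionary`, L2 `stub_aprioriTransfer` (LANDED), L3 `stub_ellipticDensity`,
D `stub_calculusFacts` (LANDED), E `stub_driftAbsorption` (LANDED); `C⁺ = quantPersistenceCore_of_lattice` proved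
in the skeleton from L1–L3 + A + B.

## Findings (index)

1. **No unconditional kill exists short of settling two open problems** (`not_newtonRealisation_iff`):
   `¬NewtonRealisation ↔ NonresonantTaylorWaves ∧ ¬B`; `B` is refuted only by `SteadyNeg` (stmt-0222, open) and
   `NonresonantTaylorWaves` is the route target (open construction).  Under `SteadyNeg` the crux is EQUIVALENT to
   `¬NonresonantTaylorWaves` (`newtonRealisation_iff_not_target_of_steadyNeg`).
2. **Junk / vacuity / triviality: none — and the a-priori clause is INHABITED** (LANDED `Negative/BorderedBoundShear.lean`
   p160675; `Negative/BorderedBoundInhabited.lean` p161165 submitted): for every `ν > 0` the axial shear state `u₀ = ν sin(2πx₃)e₀`,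
   drift `c = 0`, carries the bordered bound VERBATIM with `M = 5/ν` (`borderedBound_shear`, energy method); it is an
   exact drifted steady state of `f₀ = 4π²νu₀` with `|u₀| ≤ ν`, `|∂u₀| ≤ 2πν`, `‖∂₃u₀‖₂² = 2π²ν²` (`shear_exact`,
   `shear_data`), so ALL inner hypotheses of the transfer `C⁺` hold jointly for every `0 < ν ≤ 1` with `C = 2π`,
   `M = 5ν⁻¹` (`quantPersistence_hypotheses_inhabited`): stub C / L2–L3 are NOT vacuous, and the
   clause has no sign slip.  `B` is not junk-inhabited; `IsClassicalNSSolutionOn` has no mean-zero field, so the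
   drift absorption `u = W − c'e₃` is admissible.
3. **Load-bearing hypotheses** (all LANDED under `Theorems/NewtonRealisation/Negative/`):
   * the BORDER of the a-priori bound — `TranslationKernel.lean` (p158831): at an exact state of an `x₃`-invariant
     force `(∂₃u₀, ∂₃p₀)` is an exact kernel vector of the unbordered linearisation; no unbordered `L²` bound holds;
     bordered ⊥ unbordered there (target T1 of card force-side-persistence, corrected: the unbordered variant of `C⁺`
     is VACUOUS on the crux's states, not false).  Planar bases excluded (sibling `bordered_false_of_planar`).
   * `HasZeroMean f` in `C⁺` — `BorderedBoundInhabited.lean`: `quantPersistence_false_without_meanZero_f` (force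
     `f₀ + P⁻²e₀` in the Kantorovich ball at the shear state; mean obstruction `integral_steadyLHS_eq_zero`).
   * `HasZeroMean W` in stub E — `DriftAbsorptionZeroMean.lean` (p159170): energy clause false at `W ≡ e₃`, `c' = 1`.
   * residual order `K` with `C₀, K₀` fixed BEFORE `K` (Kantorovich premise, `K = 4k(K₀+1)+3`); sup bounds `|w|`,
     `|∂w|` (elliptic step L3).  **`|∂ᵢ∂ⱼ w| ≤ Cν⁻²` is NOT consumed by the line** (`perStep` takes `hsup₀`, `hsup₁`
     only): possibly unnecessary in the crux — planner information.
4. **All stubs resist a degenerate-instance audit** (§4): A (`c•1 + compact`, index 0), B (contraction with radius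
   `2Pρ`, `q ≤ ½`), L1 (dictionary: `x₀(k) = |k|²û₀(k) ∈ W`, `cf[x](0) = 0⁻¹•x(0) = 0` consistent with mean-zero
   synthesis, `Π_0 f̂(0) = 0` by `HasZeroMean f`), L2 (landed), L3 (`M = 0`, `x₀ = 0`/`D₃x₀ = 0`, `C = 0` all make
   the lattice a-priori hypothesis unsatisfiable — vacuous, consistent with finding 3; otherwise the elliptic step is
   explicitly polynomial: `4π²ν‖h‖ ≤ ‖T‖ + 2π(|c|+C)√(‖ȟ‖‖h‖) + √3Cν⁻¹‖ȟ‖ + Cν⁻¹|η|`, `‖ȟ‖, |η| ≤ M(‖T‖+|ℓh|)`),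
   D, E (landed).  Verdict: the line is sound; no stub is false as stated.
5. **T2 (ν-free radius) undecided, probably NOT a kill**: `M` is itself `≳` the resolvent norm (`M = 5/ν` already for
   the shear state), so `(1+M)^k` absorbs powers of `ν⁻¹`; not pursued.
-/

set_option linter.dupNamespace false

noncomputable section

namespace Summit.AnomalousDissipation.AnomalousDissipation.Cruxes.NewtonRealisation.Disproof

open MeasureTheory Filter Topology
open Literature.Analysis.FunctionSpaces Literature.Analysis.FunctionSpaces.Torus
open Summit.AnomalousDissipation.AnomalousDissipation.Theses.NeutralTaylorWaves
open Summit.AnomalousDissipation.AnomalousDissipation.Theorems.NewtonRealisation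

/-! ## §1 Structure: what a refutation would have to be -/

/-- The crux's conclusion `B`: the steady zeroth-law family (body of stmt-0219, verbatim). -/
abbrev SteadyFamily : Prop :=
  ∃ f : UnitAddTorus (Fin 3) → EuclideanSpace ℝ (Fin 3), Literature.Analysis.FunctionSpaces.Torus.IsSmooth f ∧ Literature.Analysis.FunctionSpaces.Torus.IsDivFree f ∧ Literature.Analysis.FunctionSpaces.Torus.HasZeroMean f ∧ ∃ (ν : ℕ → ℝ) (u : ℕ → UnitAddTorus (Fin 3) → EuclideanSpace ℝ (Fin 3)) (p : ℕ → UnitAddTorus (Fin 3) → ℝ), (∀ j, 0 < ν j) ∧ Filter.Tendsto ν Filter.atTop (nhds 0) ∧ (∀ j, Literature.Analysis.FunctionSpaces.Torus.IsClassicalNSSolutionOn Set.univ (ν j) (fun _ => f) (fun _ => u j) (fun _ => p j)) ∧ (∃ E : ℝ, ∀ j, MeasureTheory.integral MeasureTheory.volume (fun x => ‖u j x‖ ^ 2) ≤ E) ∧ ∃ ε₁ : ℝ, 0 < ε₁ ∧ ∀ j, ε₁ ≤ ν j * Literature.Analysis.FunctionSpaces.Torus.gradNormSq (u j)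

/-- The crux is literally `target → B`. -/
theorem newtonRealisation_iff : NewtonRealisation ↔ (NonresonantTaylorWaves → SteadyFamily) := Iff.rfl

/-- `B` alone proves the crux (so the crux is WEAKER than stmt-0219). -/
theorem newtonRealisation_of_steadyFamily (h : SteadyFamily) : NewtonRealisation := fun _ => h

/-- `¬ target` alone proves the crux (vacuously). -/
theorem newtonRealisation_of_not_target (h : ¬ NonresonantTaylorWaves) : NewtonRealisation :=
  fun hX => absurd hX h

/-- **Why it resists.** A refutation of the crux is EXACTLY a construction of the route target together
with a refutation of the steady zeroth law (stmt-0219): both open. -/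
theorem not_newtonRealisation_iff : ¬ NewtonRealisation ↔ (NonresonantTaylorWaves ∧ ¬ SteadyFamily) := by
  constructor
  · intro h
    by_cases hX : NonresonantTaylorWaves
    · exact ⟨hX, fun hB => h fun _ => hB⟩
    · exact absurd (newtonRealisation_of_not_target hX) h
  · rintro ⟨hX, hB⟩ h
    exact hB (h hX)

/-- `SteadyNeg` (stmt-0222, shared crux of routes CoherentStates/Neg/SteadyWeakLimit; open) refutes `B`. -/
theorem not_steadyFamily_of_steadyNeg
    (hNeg : Summit.AnomalousDissipation.AnomalousDissipation.Theses.SteadyWeakLimit.SteadyNeg) :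
    ¬ SteadyFamily := by
  rintro ⟨f, hf, hfd, hfm, ν, u, p, hν, hν0, hsol, hE, ε₁, hε₁, hfloor⟩
  have hlim := hNeg f hf hfd hfm ν u p hν hν0 hsol hE
  have hev : ∀ᶠ j in Filter.atTop, ν j * gradNormSq (u j) < ε₁ :=
    (Filter.Tendsto.eventually_lt_const hε₁ hlim)
  obtain ⟨j, hj⟩ := hev.exists
  exact absurd (hfloor j) (not_le.2 hj)

/-- Under `SteadyNeg` the crux is equivalent to the NEGATION of the route target. -/
theorem newtonRealisation_iff_not_target_of_steadyNeg
    (hNeg : Summit.AnomalousDissipation.AnomalousDissipation.Theses.SteadyWeakLimit.SteadyNeg) :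
    NewtonRealisation ↔ ¬ NonresonantTaylorWaves :=
  ⟨fun h hX => not_steadyFamily_of_steadyNeg hNeg (h hX), newtonRealisation_of_not_target⟩

/-! ## §2 The a-priori clause: load-bearing border, and non-vacuity (all landed; cited by name)

* `Negative.linearisation_translationMode_eq_zero`, `Negative.unborderedBound_false_of_exact`,
  `Negative.unborderedBound_false_of_borderedBound` (`TranslationKernel.lean`, p158831);
* `NonresonantSelection.Negative.bordered_one_le`, `bordered_false_of_planar`, `bordered_false_without_meanZero`
  (sibling, `Theorems/NonresonantSelection/Negative/BorderedTestVectors.lean`);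
* `Negative.borderedBound_shear` (`BorderedBoundShear.lean`, p160675), `Negative.shear_exact`, `Negative.shear_data`,
  `Negative.quantPersistence_hypotheses_inhabited`, `Negative.integral_steadyLHS_eq_zero`,
  `Negative.quantPersistence_false_without_meanZero_f` (`BorderedBoundInhabited.lean`);
* `Negative.driftAbsorption_energy_false_without_zeroMean` (`DriftAbsorptionZeroMean.lean`, p159170). -/

/-- Any witness `w` of the crux's hypothesis at a selected `n` is genuinely three-dimensional:
`∫‖∂₃w‖² > 0` (from the sibling border test, for the crux's constant `C₀ (ν n)⁻¹ ^ K₀`). -/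
theorem target_witness_not_planar {ν C₀ c : ℝ} {K₀ : ℕ}
    {w : UnitAddTorus (Fin 3) → EuclideanSpace ℝ (Fin 3)}
    (hap : ∀ (v : UnitAddTorus (Fin 3) → EuclideanSpace ℝ (Fin 3)) (r : UnitAddTorus (Fin 3) → ℝ) (b : ℝ),
      IsSmooth v → IsSmooth r → IsDivFree v → HasZeroMean v →
      MeasureTheory.integral MeasureTheory.volume (fun x => ‖v x‖ ^ 2) + b ^ 2 ≤
        (C₀ * ν⁻¹ ^ K₀) ^ 2 * (MeasureTheory.integral MeasureTheory.volume (fun x =>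
          ‖Torus.convect w v x + Torus.convect v w x - ν • Torus.laplacian v x + Torus.gradient r x -
            c • Torus.partialDeriv (2 : Fin 3) v x - b • Torus.partialDeriv (2 : Fin 3) w x‖ ^ 2) +
          (MeasureTheory.integral MeasureTheory.volume (fun x =>
            inner ℝ (v x) (Torus.partialDeriv (2 : Fin 3) w x))) ^ 2)) :
    0 < MeasureTheory.integral MeasureTheory.volume
      (fun x => ‖Torus.partialDeriv (2 : Fin 3) w x‖ ^ 2) := by
  have h1 := Summit.AnomalousDissipation.AnomalousDissipation.Theorems.NonresonantSelection.Negative.bordered_one_le hap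
  by_contra hle
  rw [not_lt] at hle
  have hnn : 0 ≤ MeasureTheory.integral MeasureTheory.volume
      (fun x => ‖Torus.partialDeriv (2 : Fin 3) w x‖ ^ 2) := integral_nonneg fun _ => by positivity
  rw [le_antisymm hle hnn, mul_zero] at h1
  exact absurd h1 (by norm_num)

/-- **Consequence of the translation-kernel lemma for the crux's OUTPUT.** The exact drifting steady
states `(W, Q, c')` the line produces from an `x₃`-invariant force are DEGENERATE for the unbordered
linearised steady operator: `∂₃W` (with pressure `∂₃Q`) is an exact kernel vector; any continuation of
these states (in `ν`, or in the force) must factor the `x₃`-phase, exactly as the crux's border does. -/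
theorem crux_output_translation_degenerate {ν c' : ℝ}
    {W f : UnitAddTorus (Fin 3) → EuclideanSpace ℝ (Fin 3)} {Q : UnitAddTorus (Fin 3) → ℝ}
    (hW : IsSmooth W) (hQ : IsSmooth Q)
    (heq : ∀ x, Torus.convect W W x - ν • Torus.laplacian W x + Torus.gradient Q x -
        c' • Torus.partialDeriv (2 : Fin 3) W x = f x)
    (hf : ∀ x, Torus.partialDeriv (2 : Fin 3) f x = 0) (x : UnitAddTorus (Fin 3)) :
    Torus.convect W (Torus.partialDeriv (2 : Fin 3) W) x +
        Torus.convect (Torus.partialDeriv (2 : Fin 3) W) W x -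
        ν • Torus.laplacian (Torus.partialDeriv (2 : Fin 3) W) x +
        Torus.gradient (Torus.partialDeriv (2 : Fin 3) Q) x -
        c' • Torus.partialDeriv (2 : Fin 3) (Torus.partialDeriv (2 : Fin 3) W) x = 0 :=
  Negative.linearisation_translationMode_eq_zero hW hQ heq hf x

/-- **The a-priori clause is inhabited, re-exported**: at every `0 < ν` the axial shear state carries the
crux's bordered bound with `M = 5ν⁻¹` (landed `Negative.borderedBound_shear`; the joint satisfiability of ALL
inner hypotheses of `C⁺` is `Negative.quantPersistence_hypotheses_inhabited` of `BorderedBoundInhabited.lean`). -/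
example {ν : ℝ} (hν : 0 < ν) :=
  Negative.borderedBound_shear (ν := ν) hν

/-! ## §3 Degenerate-instance audit of the line's stubs — all consistent (no stub is false as stated)

* Stub A (`stub_borderedFredholm`, landed): `T(x,t) = (c x + K x − t e, φ x) = c·1_{E×ℝ} + compact`: index 0,
  injective ⇒ homeomorphism.  `E = 0` / `e = 0`: kernel ∋ `(0, t)`, hypothesis fails — vacuous.  `E = ℝ`: `det = eφ`.
* Stub B (`stub_quadraticNewton`, landed): `G = id − A⁻¹Φ` maps the closed `2Pρ`-ball to itself with contraction
  factor `q = 2P²(2C_B+2‖D‖)ρ ≤ ½` exactly under the premise; `ρ = 0`: `(x₀, β₀)`; `E = 0`: `A` cannot be an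
  equivalence — vacuous; `E = ℝ`: `x = x₀`, `|β − β₀| = ρ/|dx₀| ≤ Pρ` since `‖A⁻¹‖ ≥ 1/|dx₀|`.
* Stub L1 (`stub_latticeDictionary`): (D1) `x₀(k) = |k|²û₀(k)` lies in `W` (zero mode, transversality, conjugate
  symmetry, `H²`), the Leray-projected drifted equation coordinatewise; `k = 0`: `f̂₀(0) = 0` and `(u₀·∇u₀)^(0) = 0`.
  (D2) `cf[x](0) = 0⁻¹ • x(0) = 0` (junk inverse) agrees with the MEAN-ZERO synthesis; `IsDivFree f` is an extra,
  harmless hypothesis (a gradient part would be absorbed by `p`).  (D3) `Π`-projected coefficients are unweighted,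
  matching the force side of the lattice equation; Parseval gives the contraction.  Consistent.
* Stub L2 (`stub_aprioriTransfer`, landed by the lead).
* Stub L3 (`stub_ellipticDensity`): the lattice a-priori hypothesis is unsatisfiable when `M = 0` (`η = 1, h = 0`),
  when `D₃x₀ = 0` (e.g. `x₀ = 0`, or `C = 0` forcing `u₀ = 0`: take `h = 0`, `η = 1`) — vacuous there, in line with the
  border analysis; otherwise the elliptic step is explicitly polynomial (finding 4) and density of finitely supported
  symmetric truncations in `W` passes the bound to all `h`.  TRUE as stated; `ℓ` is arbitrary but tied to the state
  through the hypothesis.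
* Stubs D, E: landed.
-/

/-! ## §4 Targets (lead's stuck stubs): none posted.  Open stubs at v2: L1, L3 (both audited consistent). -/

end Summit.AnomalousDissipation.AnomalousDissipation.Cruxes.NewtonRealisation.Disproof

end
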